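import Literature.AlgebraicTopology.CharacteristicClasses.TopologicalChernClassesProofs
import Literature.AlgebraicTopology.CharacteristicClasses.LineEulerNumberLocalization
import HarnessLib

/-!
# The Thom class of a complex vector bundle on its projective completion `P(E ⊕ ℂ)`

A. Grothendieck, *La théorie des classes de Chern*, Bull. SMF 86 (1958), §3–§4, in the account
of D. Husemoller, *Fibre Bundles* (3rd ed. 1994), Ch. 17 §2 Def. 2.6 (the classes through the
relation `aⁿ = -Σ xᵢ(ξ) aⁿ⁻ⁱ` on `P(ξ)`), Ch. 17 §7–§8 (the Thom class and `e(ξ) = s₀^* U`,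
Thm. 8.3) and Ch. 17 Exercises 3 and 6 (`cₙ(ξ) = e(ξ_ℝ)`; the ideal `ker(H^*(P(ξ ⊕ θ¹)) → H^*(P(ξ)))`
is generated by `a = Σ xᵢ(ξ) a_{ξ ⊕ θ¹}^{n-i}`), with R. Bott, L. Tu, *Differential Forms in
Algebraic Topology* (1982), §20–§21 (the projectivization `P(E ⊕ 1)` compactifies `E` by the
divisor at infinity `P(E)`; (20.7), (21.9): the Poincaré dual of the zero section and the Euler
class read off the relation `xⁿ + c₁xⁿ⁻¹ + ⋯ + cₙ = 0`) and J. Milnor, J. Stasheff,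
*Characteristic Classes* (1974), §14 (the top Chern class is the Euler class).

For a complex vector bundle `E` of rank `k ≥ 1` over `B` (the tree's bundled
`ComplexVectorBundle`, Grothendieck classes `chernClassR`, `GrothendieckChernClasses`) let
`Ê = E ⊕ θ¹` (`compl`), `D = P(Ê) → B` its projective bundle (`Ê.Proj`, which is the projective
completion `ProjCompl E.F E.E` of `ProjectiveCompletion.lean`, definitionally: `proj_compl_eq`),
`q̂ : D → B`, and `y = e(λ_Ê) ∈ H²(D; R)` the class of the tautological line bundle (`xClass`).
We define the **Thom class in the projective-completion model**

  `t_E(R) := yᵏ + Σ_{j<k} q̂^* c_{k-j}(E) ⌣ yʲ ∈ H²ᵏ(D; R)`   (`complThomClass`)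

(the defining polynomial of the Chern classes of `E`, evaluated at the class `y` of the BIGGER
bundle; Husemoller Ch. 17 Exercise 6) and prove its two characteristic properties:

* **`map_complSection_complThomClass`**: `ŝ^* t_E = c_k(E)` for the projectivisation
  `ŝ = [s : 1] : B → D` of ANY continuous section `s` of `E` (`complSection` = `projSection` of
  `LineEulerNumberLocalization`), in particular for the zero section `s₀ = [0 : 1]`
  (`map_complZero_complThomClass`, `map_complZero_complThomClass_int`): `ŝ^* y = 0`
  (`map_complSection_yClass`), because along `ŝ` the tautological line is the trivial line
  spanned by `(s, 1)` — the projectivisation of the bundle map `θ¹ → Ê`, `c ↦ (c • s, c)`,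
  composed with `b ↦ (b, [1])` IS `ŝ` (`ProjectiveBundleMap.map_lineEuler_eq`,
  `xClass_eq_of_rank_one`, and `e(θ¹) = 0`, `eL_trivial_eq_zero`) — so only the constant term
  `c_k(E) ⌣ y⁰` survives;
* **`map_complIncl_complThomClass`**: `ι^* t_E = 0` for the inclusion `ι : P(E) ↪ P(E ⊕ ℂ)` of
  the divisor at infinity (`complIncl`, induced by `E → Ê`, `v ↦ (v, 0)`): `ι^* y = x_E`
  (`map_complIncl_yClass`) and `q̂ ∘ ι = q`, so `ι^* t_E` is the defining relation
  `x_Eᵏ + Σ q^* c_{k-j}(E) x_Eʲ = 0` of `c(E)` (`isChernFamily_chernClassR`).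

Hence `t_E` restricts to `c_k(E)` along the zero section and to `0` on the divisor at infinity —
the Thom class of `E` in the compact model `(D, P(E))` of the pair `(E, E ∖ 0)`.  Its vanishing on
the whole vector part `D ∖ s₀(B)` (which retracts onto `ι(P(E))`), the relative lift and the
localisation of `⟨c_k(E), [B]⟩` at the zeros of a section are the sequels.  Everything is
proved; no named facts.

## References

* A. Grothendieck, *La théorie des classes de Chern*, Bull. Soc. Math. France 86 (1958)
  137–154, §3–§4. [Grothendieck1958]
* D. Husemoller, *Fibre Bundles*, 3rd ed., GTM 20, Springer 1994, Ch. 17 Def. 2.6, Prop. 3.3,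
  Prop. 4.1, Thm. 8.3, Exercises 1, 3, 6. [HusemollerFibreBundles1994]
* R. Bott, L. W. Tu, *Differential Forms in Algebraic Topology*, GTM 82, Springer 1982, §20
  (20.7), §21 (21.9). [BottTu1982]
* J. Milnor, J. Stasheff, *Characteristic Classes*, Ann. of Math. Stud. 76, PUP 1974, §14.
  [MilnorStasheff1974]
-/

noncomputable section

open CategoryTheory Function Set Bundle Module Filter Topology
  Literature.AlgebraicTopology.SingularHomology
open scoped LinearAlgebra.Projectivization

namespace Literature.AlgebraicTopology.CharacteristicClasses

namespace ComplexVectorBundle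

variable {B : Type} [TopologicalSpace B] (E : ComplexVectorBundle.{0, 0} B)

/-! ### The completed bundle `Ê = E ⊕ θ¹` -/

/-- **The completed bundle `Ê = E ⊕ θ¹`**, whose projective bundle `P(E ⊕ ℂ)` is the projective
completion of `E` (Husemoller Ch. 17 Exercise 6; Bott–Tu §20: "the projectivization
`P(E ⊕ 1)`"). [cite: HusemollerFibreBundles1994, Ch. 17 Exercise 6] -/
abbrev compl : ComplexVectorBundle.{0, 0} B := E.directSum (trivial B ℂ)

/-- `rank Ê = rank E + 1`. [folklore] -/
theorem rank_compl : E.compl.rank = E.rank + 1 := by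
  rw [compl, rank_directSum, rank_trivial, Module.finrank_self]

/-- `rank Ê > 0`. [folklore] -/
theorem rank_compl_pos : 0 < E.compl.rank := by
  rw [rank_compl]; exact Nat.succ_pos _

/-- `P(E ⊕ ℂ)` is the projective completion of `ProjectiveCompletion.lean` (same space).
[cite: HusemollerFibreBundles1994, Ch. 17 Exercise 6] -/
theorem proj_compl_eq : E.compl.Proj = ProjCompl E.F E.E := rfl

/-! ### The divisor at infinity `ι : P(E) ↪ P(E ⊕ ℂ)` -/

/-- The bundle map `E → Ê`, `v ↦ (v, 0)`, fibrewise. [cite: BottTu1982, §20] -/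
abbrev complInclMap (b : B) : E.E b →ₗ[ℂ] E.compl.E ((ContinuousMap.id B) b) :=
  LinearMap.inl ℂ (E.E b) ℂ

/-- `v ↦ (v, 0)` is injective. [folklore] -/
theorem complInclMap_injective (b : B) : Injective (E.complInclMap b) := LinearMap.inl_injective

/-- **`E → Ê`, `v ↦ (v, 0)`, has a continuous total map.** [folklore] -/
theorem continuous_complInclMap :
    Continuous fun p : TotalSpace E.F E.E ↦
      (⟨(ContinuousMap.id B) p.proj, E.complInclMap p.proj p.2⟩ : TotalSpace E.compl.F E.compl.E) := by
  have h₂ : Continuous fun p : TotalSpace E.F E.E ↦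
      (⟨p.proj, (0 : ℂ)⟩ : TotalSpace (trivial B ℂ).F (trivial B ℂ).E) :=
    (Trivialization.continuous_zeroSection ℂ (F := ℂ) (E := Bundle.Trivial B ℂ)).comp
      (FiberBundle.continuous_proj E.F E.E)
  exact continuous_directSum_mk E (trivial B ℂ) TotalSpace.proj (fun p ↦ p.2) (fun _ ↦ (0 : ℂ))
    continuous_id h₂

/-- Every line of `E` is mapped to a line of `Ê` (injectivity). [folklore] -/
theorem mem_mapDom_complInclMap (hE : 0 < E.rank) (m : E.Proj) : m ∈ E.mapDom E.compl (E.k0 hE) E.complInclMap := by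
  rw [E.mapDom_eq_univ E.compl (E.k0 hE) E.complInclMap E.complInclMap_injective]
  exact mem_univ _

/-- **The inclusion of the divisor at infinity `ι : P(E) → P(E ⊕ ℂ)`, `(b, ℓ) ↦ (b, ℓ ⊕ 0)`**
(Bott–Tu §20: `P(E) ⊂ P(E ⊕ 1)` the hyperplane at infinity). [cite: BottTu1982, §20] -/
def complIncl (hE : 0 < E.rank) : C(E.Proj, E.compl.Proj) :=
  E.projComp E.compl (E.k0 hE) E.complInclMap E.continuous_complInclMap (ContinuousMap.id E.Proj)
    (E.mem_mapDom_complInclMap hE)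

/-- `ι` covers the identity: `q̂ ∘ ι = q`. [folklore] -/
theorem projMap_comp_complIncl (hE : 0 < E.rank) :
    E.compl.projMap.comp (E.complIncl hE) = (ContinuousMap.id B).comp E.projMap := rfl

/-! ### Projectivised sections `ŝ = [s : 1] : B → P(E ⊕ ℂ)` -/

section Sections

variable (s : ∀ b, E.E b) (hs : Continuous fun b ↦ (⟨b, s b⟩ : TotalSpace E.F E.E))

/-- **The projectivised section `ŝ = [s : 1] : B → P(E ⊕ ℂ)`** — the `projSection` of
`LineEulerNumberLocalization`, typed into `Ê.Proj`. [cite: MilnorStasheff1974, §9] -/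
def complSection : C(B, E.compl.Proj) := projSection s hs

/-- It is `projSection`. [folklore] -/
theorem complSection_eq : E.complSection s hs = projSection s hs := rfl

/-- `ŝ b = (b, [s b : 1])`. [folklore] -/
theorem complSection_apply (b : B) :
    E.complSection s hs b = ⟨b, Projectivization.mk ℂ (show E.compl.E b from (s b, (1 : ℂ))) (pair_one_ne_zero (s b))⟩ :=
  rfl

/-- `q̂ ∘ ŝ = 𝟙`. [folklore] -/
theorem projMap_comp_complSection :
    E.compl.projMap.comp (E.complSection s hs) = (ContinuousMap.id B).comp (ContinuousMap.id B) := rfl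

/-- The bundle map `θ¹ → Ê`, `c ↦ (c • s(b), c)`, of the section `s`, fibrewise. [cite: HusemollerFibreBundles1994, Ch. 17 Thm. 8.3 (proof)] -/
abbrev sectionComplMap (b : B) : (trivial B ℂ).E b →ₗ[ℂ] E.compl.E ((ContinuousMap.id B) b) :=
  (LinearMap.toSpanSingleton ℂ (E.E b) (s b)).prod LinearMap.id

/-- `c ↦ (c • s(b), c)` is injective (second component). [folklore] -/
theorem sectionComplMap_injective (b : B) : Injective (E.sectionComplMap s b) :=
  fun _ _ h ↦ congrArg Prod.snd h

include hs in
/-- **`θ¹ → Ê`, `(b, c) ↦ (c • s(b), c)`, has a continuous total map.** [folklore] -/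
theorem continuous_sectionComplMap :
    Continuous fun p : TotalSpace (trivial B ℂ).F (trivial B ℂ).E ↦
      (⟨(ContinuousMap.id B) p.proj, E.sectionComplMap s p.proj p.2⟩ : TotalSpace E.compl.F E.compl.E) := by
  -- the scalar coordinate and the first component `c • s(b)`
  have hc : Continuous fun p : TotalSpace (trivial B ℂ).F (trivial B ℂ).E ↦ (p.2 : ℂ) :=
    continuous_snd.comp (Bundle.Trivial.homeomorphProd B ℂ).continuous
  have h₁ : Continuous fun p : TotalSpace (trivial B ℂ).F (trivial B ℂ).E ↦
      (⟨p.proj, (show ℂ from p.2) • s p.proj⟩ : TotalSpace E.F E.E) :=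
    (continuous_totalSpace_smul ℂ E.F E.E).comp
      (hc.prodMk (hs.comp (FiberBundle.continuous_proj (trivial B ℂ).F (trivial B ℂ).E)))
  have h₂ : Continuous fun p : TotalSpace (trivial B ℂ).F (trivial B ℂ).E ↦
      (⟨p.proj, p.2⟩ : TotalSpace (trivial B ℂ).F (trivial B ℂ).E) := continuous_id
  exact continuous_directSum_mk E (trivial B ℂ) TotalSpace.proj (fun p ↦ (show ℂ from p.2) • s p.proj) (fun p ↦ p.2) h₁ h₂

end Sections

/-- The section `b ↦ (b, [1])` of `P(θ¹) → B` is continuous. [folklore] -/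
private theorem continuous_oneLine :
    Continuous fun b : B ↦
      (⟨b, Projectivization.mk ℂ (show (trivial B ℂ).E b from (1 : ℂ)) (fun h ↦ one_ne_zero (α := ℂ) h)⟩ :
        (trivial B ℂ).Proj) := by
  refine continuous_iff_continuousAt.2 fun b₀ ↦ ?_
  refine (trivial B ℂ).continuousAt_proj_of_eventuallyEq _ b₀ (fun b ↦ b)
    (fun b ↦ show (trivial B ℂ).E b from (1 : ℂ)) (fun b h ↦ one_ne_zero (α := ℂ) h) ?_
    (Eventually.of_forall fun _ ↦ rfl)
  exact ((Bundle.Trivial.homeomorphProd B ℂ).isInducing.continuous_iff.2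
    (continuous_id.prodMk continuous_const)).continuousAt

/-- The zero section `s₀ = [0 : 1]` is the projectivisation of the zero section of `E`. [folklore] -/
theorem complSection_zero :
    E.complSection (fun _ ↦ 0) (Trivialization.continuous_zeroSection ℂ) = complZero E.F E.E := rfl

/-! ### The class `y` and the Thom class `t_E` -/

variable [T2Space B] [ParacompactSpace B] (R : Type) [CommRing R]

/-- **The class `y = e(λ_Ê) ∈ H²(P(E ⊕ ℂ); R)`** of the tautological line bundle of the completion
(Husemoller's `-a_{ξ ⊕ θ¹}`). [cite: HusemollerFibreBundles1994, Ch. 17 §2] -/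
abbrev yClass : singularCohomology R R E.compl.Proj 2 := E.compl.xClass R E.rank_compl_pos

/-- **The Thom class of `E` on `P(E ⊕ ℂ)`**: `t_E = yᵏ + Σ_{j<k} q̂^* c_{k-j}(E) ⌣ yʲ ∈ H²ᵏ`, the
defining polynomial of `c(E)` (Husemoller Def. 2.6) evaluated at the class `y` of the completed
bundle (Husemoller Ch. 17 Exercise 6: the generator of `ker(H^*(P(ξ ⊕ θ¹)) → H^*(P(ξ)))`;
Bott–Tu (20.7), (21.9)). [cite: HusemollerFibreBundles1994, Ch. 17 Def. 2.6 and Exercise 6]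
[cite: BottTu1982, §20 (20.7)] -/
def complThomClass : singularCohomology R R E.compl.Proj (2 * E.rank) :=
  cupPow R (E.yClass R) E.rank +
    lhSum R E.compl.projMap (E.yClass R) (K := 2 * E.rank) (fun j : Fin E.rank ↦ 2 * (E.rank - (j : ℕ)))
      (fun j ↦ by have := j.isLt; omega) (fun j : Fin E.rank ↦ E.chernClassR R (E.rank - (j : ℕ)))

/-! ### Algebra: the polynomial along a map with `u^* y = 0`, resp. `u^* y = x_E` -/

omit [T2Space B] [ParacompactSpace B] in
/-- `0ʲ = 0` in `H²ʲ` for `j ≥ 1`. [folklore] -/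
private theorem cupPow_zero_of_pos' {X' : Type} [TopologicalSpace X'] :
    ∀ {j : ℕ}, 0 < j → cupPow R (0 : singularCohomology R R X' 2) j = 0
  | 0, h => absurd h (lt_irrefl 0)
  | j + 1, _ => by rw [cupPow_succ, map_zero]

/-- **Along `u : Z → D` over `q₁ : Z → B` with `u^* y = 0` the Thom class pulls back to
`q₁^* c_k(E)`** (only the constant term of the polynomial survives). [cite: HusemollerFibreBundles1994, Ch. 17 Def. 2.6] -/
theorem map_complThomClass_of_map_yClass_eq_zero {Z : Type} [TopologicalSpace Z] (q₁ : C(Z, B))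
    (u : C(Z, E.compl.Proj)) (hug : E.compl.projMap.comp u = (ContinuousMap.id B).comp q₁)
    (hu : singularCohomology.map R R u 2 (E.yClass R) = 0) (hE : 0 < E.rank) :
    singularCohomology.map R R u (2 * E.rank) (E.complThomClass R) =
      singularCohomology.map R R q₁ (2 * E.rank) (E.chernClassR R E.rank) := by
  rw [complThomClass, map_add, map_cupPow, hu, cupPow_zero_of_pos' R hE, zero_add,
    map_lhSum R q₁ E.compl.projMap u (ContinuousMap.id B) hug 0 (E.yClass R) hu, lhSum,
    Finset.sum_eq_single (⟨0, hE⟩ : Fin E.rank)]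
  · -- the surviving term `q₁^* c_k ⌣ 1`
    change cupProduct (Nat.add_zero (2 * E.rank))
      (singularCohomology.map R R q₁ (2 * E.rank)
        (singularCohomology.map R R (ContinuousMap.id B) (2 * E.rank) (E.chernClassR R E.rank)))
      (singularCohomology.one R Z) = _
    rw [cupProduct_one, singularCohomology.map_id, ModuleCat.id_apply]
  · intro j _ hj
    have hj' : 0 < (j : ℕ) := Nat.pos_of_ne_zero fun h0 ↦ hj (Fin.ext h0)
    rw [cupPow_zero_of_pos' R hj', map_zero]
  · exact fun h0 ↦ absurd (Finset.mem_univ _) h0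

/-- **Along `u : P(E) → D` over `B` with `u^* y = x_E` the Thom class pulls back to the defining
relation of `c(E)`, hence to zero.** [cite: HusemollerFibreBundles1994, Ch. 17 Def. 2.6] -/
theorem map_complThomClass_of_map_yClass_eq_xClass (hE : 0 < E.rank) (u : C(E.Proj, E.compl.Proj))
    (hug : E.compl.projMap.comp u = (ContinuousMap.id B).comp E.projMap)
    (hu : singularCohomology.map R R u 2 (E.yClass R) = E.xClass R hE) :
    singularCohomology.map R R u (2 * E.rank) (E.complThomClass R) = 0 := by
  rw [complThomClass, map_add, map_cupPow, hu,
    map_lhSum R E.projMap E.compl.projMap u (ContinuousMap.id B) hug (E.xClass R hE) (E.yClass R) hu]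
  have hfun : (fun j : Fin E.rank ↦ singularCohomology.map R R (ContinuousMap.id B) (2 * (E.rank - (j : ℕ)))
      (E.chernClassR R (E.rank - j))) = fun j : Fin E.rank ↦ E.chernClassR R (E.rank - (j : ℕ)) := by
    funext j
    rw [singularCohomology.map_id, ModuleCat.id_apply]
  rw [hfun]
  exact (E.isChernFamily_chernClassR R hE).rel

/-! ### `ι^* y = x_E` and `ι^* t_E = 0` -/

/-- **`ι^* y = x_E`**: the tautological line bundle of `Ê` restricts to that of `E` on the divisor
at infinity (`ProjectiveBundleMap.map_lineEuler_eq`). [cite: HusemollerFibreBundles1994, Ch. 17 Prop. 3.3 and Exercise 6] -/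
theorem map_complIncl_yClass (hE : 0 < E.rank) :
    singularCohomology.map R R (E.complIncl hE) 2 (E.yClass R) = E.xClass R hE := by
  have h := E.map_lineEuler_eq E.compl (E.k0 hE) (E.compl.k0 E.rank_compl_pos) E.complInclMap
    E.continuous_complInclMap (ContinuousMap.id E.Proj) (E.mem_mapDom_complInclMap hE) R 1
  rw [singularCohomology.map_id, ModuleCat.id_apply] at h
  exact h.symm

/-- **The Thom class vanishes on the divisor at infinity: `ι^* t_E = 0`** (its pull-back is the
defining relation of the Chern classes of `E`; Husemoller Ch. 17 Exercise 6: "`α(a) = 0`").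
[cite: HusemollerFibreBundles1994, Ch. 17 Def. 2.6 and Exercise 6] [cite: BottTu1982, §20 (20.7)] -/
theorem map_complIncl_complThomClass (hE : 0 < E.rank) :
    singularCohomology.map R R (E.complIncl hE) (2 * E.rank) (E.complThomClass R) = 0 :=
  E.map_complThomClass_of_map_yClass_eq_xClass R hE (E.complIncl hE) (E.projMap_comp_complIncl hE)
    (E.map_complIncl_yClass R hE)

/-! ### The Euler class of the trivial line bundle vanishes (any coefficients) -/

/-- **`e(θ¹) = 0` in `H²(B; R)`**: the trivial line bundle `B × ℂ` maps fibrewise isomorphically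
onto the trivial line bundle over a point, whose Euler class lives in `H²(pt; R) = 0`
(Husemoller Ch. 17 Prop. 4.1, proof; naturality `eulerClass_bundleMap`). [cite: HusemollerFibreBundles1994, Ch. 17 Prop. 4.1] -/
theorem eL_trivial_eq_zero (hT : (trivial B ℂ).rank = 1) (m : R) : (trivial B ℂ).eL R hT m = 0 := by
  let T : ComplexVectorBundle.{0, 0} B := trivial B ℂ
  let T' : ComplexVectorBundle.{0, 0} PUnit.{1} := trivial PUnit.{1} ℂ
  have hT' : T'.rank = 1 := Module.finrank_self ℂ
  let g : C(B, PUnit.{1}) := ContinuousMap.const B PUnit.unit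
  let φ : ∀ b, T.E b ≃L[ℂ] T'.E (g b) := fun _ ↦ ContinuousLinearEquiv.refl ℂ ℂ
  have hΨ : Continuous fun q : TotalSpace T.F T.E ↦ (⟨g q.proj, φ q.proj q.2⟩ : TotalSpace T'.F T'.E) :=
    (Bundle.Trivial.homeomorphProd PUnit.{1} ℂ).isInducing.continuous_iff.2
      (continuous_const.prodMk (continuous_snd.comp (Bundle.Trivial.homeomorphProd B ℂ).continuous))
  have h := eulerClass_bundleMap T.F T'.F T.E T'.E (T.finrank_of_rank_one hT) (T'.finrank_of_rank_one hT') R φ hΨ m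
  haveI : Subsingleton (singularCohomology R R PUnit.{1} 2) :=
    ModuleCat.subsingleton_of_isZero
      (singularCochainComplex.isZero_singularCohomology_of_subsingleton' (R := R) (M := R)
        (X := PUnit.{1}) (n := 2) two_ne_zero)
  rw [Subsingleton.elim (eulerClass T'.F T'.E (T'.finrank_of_rank_one hT') R m) 0, map_zero] at h
  exact h

/-! ### `ŝ^* y = 0` and `ŝ^* t_E = c_k(E)` -/

section Sections

variable (s : ∀ b, E.E b) (hs : Continuous fun b ↦ (⟨b, s b⟩ : TotalSpace E.F E.E))

include hs in
/-- **`ŝ^* y = 0`**: along `ŝ = [s : 1]` the tautological line of `Ê` is the trivial line spanned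
by `(s, 1)` — the projectivisation `P(θ¹) → P(Ê)` of `c ↦ (c • s, c)` composed with `b ↦ (b, [1])`
IS `ŝ`, so `ŝ^* y = e(θ¹) = 0`. [cite: HusemollerFibreBundles1994, Ch. 17 Thm. 8.3 and Prop. 3.3] -/
theorem map_complSection_yClass :
    singularCohomology.map R R (E.complSection s hs) 2 (E.yClass R) = 0 := by
  -- the trivial line bundle and its section `[1]`
  let T : ComplexVectorBundle.{0, 0} B := trivial B ℂ
  have hT : T.rank = 1 := Module.finrank_self ℂ
  have hT0 : 0 < T.rank := T.rank_pos_of_rank_one hT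
  let σ : C(B, T.Proj) :=
    ⟨fun b ↦ ⟨b, Projectivization.mk ℂ (show T.E b from (1 : ℂ)) (fun h ↦ one_ne_zero (α := ℂ) h)⟩,
      continuous_oneLine⟩
  have hζ : ∀ b, σ b ∈ T.mapDom E.compl (T.k0 hT0) (E.sectionComplMap s) := fun b ↦ by
    rw [T.mapDom_eq_univ E.compl (T.k0 hT0) (E.sectionComplMap s) (E.sectionComplMap_injective s)]
    exact mem_univ _
  -- `P(c ↦ (c • s, c)) ∘ σ = ŝ`
  have hu : T.projComp E.compl (T.k0 hT0) (E.sectionComplMap s) (E.continuous_sectionComplMap s hs) σ hζ =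
      E.complSection s hs := by
    ext1 b
    set a : ℂ := T.lineVecIn (T.k0 hT0) (T.chartAt (T.k0 hT0) (σ b)) (σ b) with ha_def
    have ha : a ≠ 0 := lineVecIn_ne_zero (T.mem_chartSet_chartAt (T.k0 hT0) (σ b))
    change (⟨b, Projectivization.mk ℂ (E.sectionComplMap s b a) _⟩ : E.compl.Proj) =
      ⟨b, Projectivization.mk ℂ (show E.compl.E b from (s b, (1 : ℂ))) (pair_one_ne_zero (s b))⟩
    congr 1
    rw [Projectivization.mk_eq_mk_iff]
    exact ⟨Units.mk0 a ha, Prod.ext rfl (mul_one a)⟩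
  -- `ŝ^* y = σ^* x_{θ¹} = σ^* q^* e(θ¹) = e(θ¹) = 0`
  have h := T.map_lineEuler_eq E.compl (T.k0 hT0) (E.compl.k0 E.rank_compl_pos) (E.sectionComplMap s)
    (E.continuous_sectionComplMap s hs) σ hζ R 1
  rw [hu] at h
  change singularCohomology.map R R σ 2 (T.xClass R hT0) =
    singularCohomology.map R R (E.complSection s hs) 2 (E.yClass R) at h
  rw [← h, T.xClass_eq_of_rank_one R hT, eL_trivial_eq_zero R hT 1, map_zero, map_zero]

include hs in
/-- **`ŝ^* t_E = c_k(E)` for every continuous section `s`** (Husemoller Thm. 8.3 `e = s₀^* U` with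
`ŝ ≃ s₀`; here directly, `ŝ^* y = 0` killing all but the constant term of the polynomial).
[cite: HusemollerFibreBundles1994, Ch. 17 Thm. 8.3 and Exercise 3] [cite: BottTu1982, §21 (21.9)] -/
theorem map_complSection_complThomClass (hE : 0 < E.rank) :
    singularCohomology.map R R (E.complSection s hs) (2 * E.rank) (E.complThomClass R) = E.chernClassR R E.rank := by
  rw [E.map_complThomClass_of_map_yClass_eq_zero R (ContinuousMap.id B) (E.complSection s hs)
    (E.projMap_comp_complSection s hs) (E.map_complSection_yClass R s hs) hE,
    singularCohomology.map_id, ModuleCat.id_apply]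

end Sections

/-- **`s₀^* t_E = c_k(E)`**: along the zero section the Thom class restricts to the top Chern
class (Husemoller Thm. 8.3: `e(ξ) = s₀^* U_ξ`; Ch. 17 Exercise 3: `cₙ(ξ) = e(ξ_ℝ)`; Bott–Tu
(21.9)). [cite: HusemollerFibreBundles1994, Ch. 17 Thm. 8.3 and Exercise 3] [cite: BottTu1982, §21 (21.9)] -/
theorem map_complZero_complThomClass (hE : 0 < E.rank) :
    singularCohomology.map R R (Y := E.compl.Proj) (complZero E.F E.E) (2 * E.rank) (E.complThomClass R) =
      E.chernClassR R E.rank := by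
  rw [← complSection_zero]
  exact E.map_complSection_complThomClass R (fun _ ↦ 0) (Trivialization.continuous_zeroSection ℂ) hE

/-- The same for the integral Chern classes `chernClassZ`: `s₀^* t_E(ℤ) = c_k(E) ∈ H²ᵏ(B; ℤ)`.
[cite: HusemollerFibreBundles1994, Ch. 17 Thm. 8.3 and Exercise 3] -/
theorem map_complZero_complThomClass_int (hE : 0 < E.rank) :
    singularCohomology.map ℤ ℤ (Y := E.compl.Proj) (complZero E.F E.E) (2 * E.rank) (E.complThomClass ℤ) =
      chernClassZ E E.rank := by
  rw [chernClassZ_eq]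
  exact E.map_complZero_complThomClass ℤ hE

end ComplexVectorBundle

end Literature.AlgebraicTopology.CharacteristicClasses

end
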